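import Literature.IUT.HodgeTheaters.GoodLocalFrobenioidOfKit
import Literature.AlgebraicGeometry.Frobenioids.PadicFrobenioidRmk122
import HarnessLib

/-!
# The [FrdII] Remark 1.2.2 unit twist `Ψ_U` (`p ↦ -p`) of the REAL `C_v = C(ℚ_p)` inside `GoodLocalFrobenioid.ofKitQp p`

Mochizuki, *The geometry of Frobenioids II*, Kyushu J. Math. **62** (2008), §1, Remark 1.2.2 p. 10
[cite: MochizukiFrdII2008, Rmk 1.2.2 p.10]: "Let `u_D : (Ob(D) ∋) A_D ↦ u_{A_D} ∈ O^×(A_D)` be a 'section' of the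
functor `O^×(−)` … one obtains a unique automorphism `U` of the data `(Φ, B → Φ^gp)` which is the identity on `O^×(−)` …
and `Φ`, but which maps `τ` … to `u_D · τ`. Thus, `U` induces a self-equivalence `Ψ_U : C ⥲ C` of the model Frobenioid
`C`. In particular, `Ψ_U` exhibits an example of a situation where `p ∈ ℚ_p^×` is mapped to some `p · u ∈ ℚ_p^×`, where
`u ∈ ℤ_p^×` — a situation which, of course, never arises in conventional scheme theory."; [IUTchI] Example 3.3 (i)(iii),
kurims May-2020 manuscript pp. 77–79 [claim: Mochizuki2012, status: disputed]. abc-iut cell, WAVE-4 seat abc-iut-w4-d047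
(gen 2); DAG node `IUTchI:Ex3.3(iii)` (row E33iii/e of `plan/L5/SUBDAG-IUTchI-Ex33-Ex34.md`).

CONSTRUCTIONS (concrete, over abc-iut-L1-t4's [FrdII] Ex. 1.1 (ii) objects; consumed by the refutation of the typed
clause Ex. 3.3 (iii)(e) `SplitFromF` at `ofKitQp p`, `GoodLocalFrobenioidOfKitSplitNegative.lean`):

* `qpPerfDatum p` / `qpPrimDatum p` — the two data inside abc-iut-L5-t2's `GoodLocalFrobenioid.ofKitQp p`: `C_v = C(ℚ_p)`
  (perfection `ord(ℤ_p^⊳)^pf` over the one-object base, pulled back along the identity) and `C⊢_v = C⊢(ℚ_p)`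
  (`Φ = ℕ·ord(p)`), with `ofKitQp_Cv`, `ofKitQp_Cdash`, `ofKitQp_tauDash` (`τ⊢_v = τ_p`, [FrdII] Thm. 1.2 (v)) by `rfl`;
* `unitsVal` — `v_p : ℚ_pˣ → ℤ`; `negOneB d A` / `negOneBUnit d A` — for ANY `p`-adic Frobenioid datum `d`, the lift
  `w_A ∈ O^×(A) ⊆ B(A) = K_A^× ×_{Φ₀^gp} Φ^gp` of `-1 ∈ K_A^×` (trivial divisor, `w_A² = 1`) — Rmk. 1.2.2's "section"
  `u_D ≡ -1`;
* `twistExp`, `twistβHom`, `twistβ`, `twistData` — the automorphism `U = (id_Φ, β)` of the data of `C(ℚ_p)`,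
  `β_A(b) := b · w_A^{v_p(b|_{K^×})}`: the identity on `O^×(−)` and on `Φ`, an involution (`twistβHom_twistβHom`),
  compatible with `Div_B` (`divB_twistβHom`); on rational functions `β(b)|_{K^×} = b|_{K^×} · (-1)^{v_p(b)}`
  (`resK_twistβHom`) — so "`p` is mapped to `-p`"; `twistData_isDataAutomorphism`;
* `twistEquiv p : (ofKitQp p).Cv ≌ (ofKitQp p).Cv` — `Ψ_U`, an equivalence by abc-iut-L1-t4's PROVED
  `PadicFrd.Datum.rmk122SelfEquivalence_holds` (Rmk. 1.2.2, sentence 5); `unit_twistEquiv_map`, `degFr_twistEquiv_map`.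

Nothing of the disputed series is asserted; typed ≠ proved; no side is taken on [IUTchIII] Cor. 3.12.
-/


noncomputable section

namespace Literature.IUT.HodgeTheaters

namespace GoodLocalFrobenioid

open CategoryTheory Opposite Literature.AlgebraicGeometry.Frobenioids Literature.AlgebraicGeometry.Frobenioids.PadicFrd

variable (p : ℕ) [Fact p.Prime]

/-- The [FrdII] Ex. 1.1 (ii) datum of `C_v = C(ℚ_p)` inside `ofKitQp p` (perfection `ord(ℤ_p^⊳)^pf` over the
one-object base, pulled back along the identity). [claim: Mochizuki2012, status: disputed] -/
abbrev qpPerfDatum : Datum (Discrete PUnit.{1}) p :=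
  Datum.perf (𝟭 (Discrete PUnit.{1}) ⋙ qpBase p)
    (hlocOver (𝟭 (Discrete PUnit.{1})) (qpBase p)
      (fun _ => isPadicLocal_qpFld p : ∀ A : Discrete PUnit.{1}, ((qpBase p).obj A).IsPadicLocal))
    inferInstance isTotallyEpimorphic_discretePUnit

/-- The [FrdII] Ex. 1.1 (ii) datum of `C⊢_v = C⊢(ℚ_p)` inside `ofKitQp p` (`Φ = ℕ·ord(p)`; abc-iut-L1-t4's
`Datum.primQp`). [claim: Mochizuki2012, status: disputed] -/
abbrev qpPrimDatum : Datum (Discrete PUnit.{1}) p :=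
  Datum.prim (qpBase p) (fun _ => isPadicLocal_qpFld p : ∀ A : Discrete PUnit.{1}, ((qpBase p).obj A).IsPadicLocal)
    inferInstance isTotallyEpimorphic_discretePUnit

/-- `C_v` of `ofKitQp p` IS the model Frobenioid of `qpPerfDatum p`. [claim: Mochizuki2012, status: disputed] -/
theorem ofKitQp_Cv : (ofKitQp p).Cv = (qpPerfDatum p).frobenioid := rfl

/-- `C⊢_v` of `ofKitQp p` IS the model Frobenioid of `qpPrimDatum p`. [claim: Mochizuki2012, status: disputed] -/
theorem ofKitQp_Cdash : (ofKitQp p).Cdash = (qpPrimDatum p).frobenioid := rfl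

/-- `τ⊢_v` of `ofKitQp p` IS the splitting `τ_p` of [FrdII] Thm. 1.2 (v) on `C⊢(ℚ_p)`.
[claim: Mochizuki2012, status: disputed] -/
theorem ofKitQp_tauDash (X : (qpPrimDatum p).frobenioid) :
    (ofKitQp p).tauDash.sect X = (qpPrimDatum p).pSplittingSubmonoid X := rfl

/-- The `p`-adic valuation on `ℚ_pˣ` as a homomorphism to `ℤ`. [folklore] -/
def unitsVal : ℚ_[p]ˣ →* Multiplicative ℤ where
  toFun x := Multiplicative.ofAdd ((x : ℚ_[p]).valuation)
  map_one' := by rw [Units.val_one, Padic.valuation_one]; rfl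
  map_mul' x y := by rw [← ofAdd_add, Units.val_mul, Padic.valuation_mul x.ne_zero y.ne_zero]

/-- `v_p(p) = 1` for the image of `p` in `K = ℚ_p` ([FrdII] Ex. 1.1 (i): `ord(ℤ_p^⊳) ≅ ℤ_{≥0}` generated by `ord(p)`).
[cite: MochizukiFrdII2008, Ex 1.1 (i) p.7] -/
theorem unitsVal_primeUnit (A : Discrete PUnit.{1}) :
    unitsVal p ((qpPerfDatum p).primeUnit A) = Multiplicative.ofAdd 1 := by
  change Multiplicative.ofAdd (((p : ℕ) : ℚ_[p]).valuation) = _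
  rw [Padic.valuation_p]

/-- `v_p(-1) = 0`: `-1 ∈ ℤ_p^×` ([FrdII] Ex. 1.1 (i), units of `O_K`). [cite: MochizukiFrdII2008, Ex 1.1 (i) p.7] -/
theorem unitsVal_neg_one : unitsVal p (-1) = 1 := by
  have h : unitsVal p (-1) * unitsVal p (-1) = 1 := by rw [← map_mul, neg_one_mul, neg_neg, map_one]
  have h' : (Multiplicative.toAdd (unitsVal p (-1))) + Multiplicative.toAdd (unitsVal p (-1)) = 0 := by
    rw [← toAdd_mul, h]; rfl
  have h'' : Multiplicative.toAdd (unitsVal p (-1)) = 0 := by omega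
  exact toAdd_eq_zero.mp h''


/-! ### The unit `-1` of `B(A) = K_A^× ×_{Φ₀^gp} Φ^gp` -/

section NegOne

variable {D : Type} [Category.{0} D] (d : Datum D p)

/-- `-1 ∈ O_K^×` for every field `K` under an object of the base ([FrdII] Ex. 1.1 (i): `O_K^× ⊆ K^×`).
[cite: MochizukiFrdII2008, Ex 1.1 (i) p.7] -/
theorem neg_one_mem_unitSubgroup (A : D) : (-1 : (d.fld A)ˣ) ∈ unitSubgroup (d.fld A) := by
  rw [mem_unitSubgroup_iff, Units.val_neg, Units.val_one, Valuation.map_neg, map_one]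

/-- **The element `w_A ∈ O^×(A) ⊆ B(A)` over `-1 ∈ K_A^×`** (a lift with trivial divisor, [FrdII] Ex. 1.1 (ii):
`B(A) = K_A^× ×_{Φ₀^gp(A)} Φ^gp(A)`). [cite: MochizukiFrdII2008, Ex 1.1 (ii) p.8] -/
def negOneB (A : D) : d.B.obj (op A) :=
  Classical.choose (d.exists_B_over_unit (op A) (-1) (neg_one_mem_unitSubgroup p d A))

/-- `w_A|_{K^×} = -1`. [cite: MochizukiFrdII2008, Ex 1.1 (ii) p.8] -/
theorem resK_negOneB (A : D) : d.resK A (negOneB p d A) = -1 :=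
  (Classical.choose_spec (d.exists_B_over_unit (op A) (-1) (neg_one_mem_unitSubgroup p d A))).1

/-- `Div_B(w_A) = 0`. [cite: MochizukiFrdII2008, Ex 1.1 (ii) p.8] -/
theorem divB_negOneB (A : D) :
    Literature.AlgebraicGeometry.Frobenioids.divB d.Φ d.B d.divB (op A) (negOneB p d A) = 1 :=
  (Classical.choose_spec (d.exists_B_over_unit (op A) (-1) (neg_one_mem_unitSubgroup p d A))).2

/-- `w_A² = 1`. [cite: MochizukiFrdII2008, Ex 1.1 (ii) p.8] -/
theorem negOneB_mul_self (A : D) : negOneB p d A * negOneB p d A = 1 :=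
  d.resK_ext A (by rw [map_mul, resK_negOneB, map_one, neg_one_mul, neg_neg])
    (by rw [map_mul, divB_negOneB, map_one, mul_one])

/-- `w_A` as a unit of the monoid `B(A)` (its own inverse). [cite: MochizukiFrdII2008, Ex 1.1 (ii) p.8] -/
def negOneBUnit (A : D) : (d.B.obj (op A))ˣ :=
  ⟨negOneB p d A, negOneB p d A, negOneB_mul_self p d A, negOneB_mul_self p d A⟩

/-- The underlying element of `negOneBUnit`. [cite: MochizukiFrdII2008, Ex 1.1 (ii) p.8] -/
@[simp] theorem coe_negOneBUnit (A : D) : (negOneBUnit p d A : d.B.obj (op A)) = negOneB p d A := rfl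

/-- `Div_B` kills every power `w_A^k`, `k ∈ ℤ`. [cite: MochizukiFrdII2008, Ex 1.1 (ii) p.8] -/
theorem divB_negOneBUnit_zpow (A : D) (k : ℤ) :
    Literature.AlgebraicGeometry.Frobenioids.divB d.Φ d.B d.divB (op A)
      ((negOneBUnit p d A ^ k : (d.B.obj (op A))ˣ) : d.B.obj (op A)) = 1 := by
  have h : ((Literature.AlgebraicGeometry.Frobenioids.divB d.Φ d.B d.divB (op A)).comp
      (Units.coeHom (d.B.obj (op A)))) (negOneBUnit p d A ^ k) = 1 := by
    rw [map_zpow]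
    change Literature.AlgebraicGeometry.Frobenioids.divB d.Φ d.B d.divB (op A) (negOneB p d A) ^ k = 1
    rw [divB_negOneB, one_zpow]
  exact h

/-- `(w_A^k)|_{K^×} = (-1)^k`. [cite: MochizukiFrdII2008, Ex 1.1 (ii) p.8] -/
theorem resK_negOneBUnit_zpow (A : D) (k : ℤ) :
    d.resK A ((negOneBUnit p d A ^ k : (d.B.obj (op A))ˣ) : d.B.obj (op A)) = (-1) ^ k := by
  have h : ((Units.coeHom _).comp (Units.map (d.resK A))) (negOneBUnit p d A ^ k) =
      ((-1 : (d.fld A)ˣ) : (d.fld A)ˣ) ^ k := by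
    rw [map_zpow]
    congr 1
    exact resK_negOneB p d A
  exact h

end NegOne


/-! ### The [FrdII] Remark 1.2.2 unit twist `U = (id_Φ, β)` of `C(ℚ_p)`: `β(b) = b · w^{v_p(b)}`, i.e. `p ↦ -p` -/

section Twist

/-- The twisting exponent `n(b) := v_p(b|_{K^×}) ∈ ℤ` on `B(A)`. [cite: MochizukiFrdII2008, Rmk 1.2.2 p.10] -/
def twistExp (A : Discrete PUnit.{1}) : (qpPerfDatum p).B.obj (op A) →* Multiplicative ℤ :=
  (unitsVal p).comp ((qpPerfDatum p).resK A)

/-- `n(b)` unfolded. [cite: MochizukiFrdII2008, Rmk 1.2.2 p.10] -/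
theorem twistExp_apply (A : Discrete PUnit.{1}) (b : (qpPerfDatum p).B.obj (op A)) :
    twistExp p A b = unitsVal p ((qpPerfDatum p).resK A b) := rfl

/-- `n(w^k) = 0`: the powers of the unit `w` over `-1` have valuation zero. [cite: MochizukiFrdII2008, Rmk 1.2.2 p.10] -/
theorem twistExp_negOneBUnit_zpow (A : Discrete PUnit.{1}) (k : ℤ) :
    twistExp p A ((negOneBUnit p (qpPerfDatum p) A ^ k : ((qpPerfDatum p).B.obj (op A))ˣ) : _) = 1 := by
  rw [twistExp_apply, resK_negOneBUnit_zpow]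
  change unitsVal p ((-1 : ℚ_[p]ˣ) ^ k) = 1
  rw [map_zpow, unitsVal_neg_one, one_zpow]

/-- **`β_A : B(A) → B(A)`, `b ↦ b · w^{n(b)}`** — the identity on `O^×(−)` (valuation zero) and on divisors,
sending (a lift of) `p` to (a lift of) `-p` ("`p ∈ ℚ_p^×` is mapped to some `p · u`, `u ∈ ℤ_p^×`", here `u = -1`).
[cite: MochizukiFrdII2008, Rmk 1.2.2 p.10] -/
def twistβHom (A : Discrete PUnit.{1}) : (qpPerfDatum p).B.obj (op A) →* (qpPerfDatum p).B.obj (op A) where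
  toFun b := b * ((negOneBUnit p (qpPerfDatum p) A ^ (Multiplicative.toAdd (twistExp p A b)) :
    ((qpPerfDatum p).B.obj (op A))ˣ) : (qpPerfDatum p).B.obj (op A))
  map_one' := by rw [map_one, toAdd_one, zpow_zero, Units.val_one, mul_one]
  map_mul' b c := by rw [map_mul, toAdd_mul, zpow_add, Units.val_mul, mul_mul_mul_comm]

/-- `β_A(b)` unfolded. [cite: MochizukiFrdII2008, Rmk 1.2.2 p.10] -/
theorem twistβHom_apply (A : Discrete PUnit.{1}) (b : (qpPerfDatum p).B.obj (op A)) :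
    twistβHom p A b = b * ((negOneBUnit p (qpPerfDatum p) A ^ (Multiplicative.toAdd (twistExp p A b)) :
      ((qpPerfDatum p).B.obj (op A))ˣ) : (qpPerfDatum p).B.obj (op A)) := rfl

/-- `β_A` preserves divisors: `Div_B ∘ β_A = Div_B`. [cite: MochizukiFrdII2008, Rmk 1.2.2 p.10] -/
theorem divB_twistβHom (A : Discrete PUnit.{1}) (b : (qpPerfDatum p).B.obj (op A)) :
    Literature.AlgebraicGeometry.Frobenioids.divB (qpPerfDatum p).Φ (qpPerfDatum p).B (qpPerfDatum p).divB (op A)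
        (twistβHom p A b) =
      Literature.AlgebraicGeometry.Frobenioids.divB (qpPerfDatum p).Φ (qpPerfDatum p).B (qpPerfDatum p).divB (op A) b := by
  rw [twistβHom_apply, map_mul, divB_negOneBUnit_zpow, mul_one]

/-- `β_A` on rational functions: `β_A(b)|_{K^×} = b|_{K^×} · (-1)^{v_p(b)}`. [cite: MochizukiFrdII2008, Rmk 1.2.2 p.10] -/
theorem resK_twistβHom (A : Discrete PUnit.{1}) (b : (qpPerfDatum p).B.obj (op A)) :
    (qpPerfDatum p).resK A (twistβHom p A b) =
      (qpPerfDatum p).resK A b * (-1) ^ (Multiplicative.toAdd (twistExp p A b)) := by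
  rw [twistβHom_apply, map_mul, resK_negOneBUnit_zpow]

/-- `β_A` is an involution (`w² = 1` and `n(w^k) = 0`). [cite: MochizukiFrdII2008, Rmk 1.2.2 p.10] -/
theorem twistβHom_twistβHom (A : Discrete PUnit.{1}) (b : (qpPerfDatum p).B.obj (op A)) :
    twistβHom p A (twistβHom p A b) = b := by
  have hW : negOneBUnit p (qpPerfDatum p) A ^ (2 : ℤ) = 1 := by
    rw [zpow_two]
    exact Units.ext (negOneB_mul_self p (qpPerfDatum p) A)
  rw [twistβHom_apply, twistβHom_apply, map_mul, twistExp_negOneBUnit_zpow, mul_one, mul_assoc, ← Units.val_mul,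
    ← zpow_add, ← two_mul, zpow_mul, hW, one_zpow, Units.val_one, mul_one]

/-- Every arrow of the one-object base (opposite) is an identity. [folklore] -/
private theorem eq_id_of_hom_discretePUnit_op {A : (Discrete PUnit.{1})ᵒᵖ} (f : A ⟶ A) : f = 𝟙 A := by
  have h : f.unop = 𝟙 A.unop := Subsingleton.elim _ _
  rw [← Quiver.Hom.op_unop f, h, op_id]

/-- **`β : B → B`** as an (iso)morphism of monoids on the base. [cite: MochizukiFrdII2008, Rmk 1.2.2 p.10] -/
def twistβ : (qpPerfDatum p).B ⟶ (qpPerfDatum p).B where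
  app A := CommMonCat.ofHom (twistβHom p A.unop)
  naturality {A A'} f := by
    obtain ⟨⟨⟨⟩⟩⟩ := A
    obtain ⟨⟨⟨⟩⟩⟩ := A'
    rw [eq_id_of_hom_discretePUnit_op f, CategoryTheory.Functor.map_id, Category.id_comp, Category.comp_id]

/-- **The twisting automorphism `U = (id_Φ, β)` of the data `(Φ, B → Φ^gp)` of `C(ℚ_p)`** ([FrdII] Rmk. 1.2.2:
"a unique automorphism `U` … which is the identity on `O^×(−)` … and `Φ`, but which maps `τ` to `u_D · τ`").
[cite: MochizukiFrdII2008, Rmk 1.2.2 p.10] -/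
def twistData : ModelFrobenioid.DataHom (qpPerfDatum p).divB (qpPerfDatum p).divB where
  η := 𝟙 _
  β := twistβ p
  comm A u := by
    obtain ⟨⟨⟨⟩⟩⟩ := A
    change MonGp.map (MonoidHom.id _) _ = Literature.AlgebraicGeometry.Frobenioids.divB _ _ _ _ (twistβHom p _ u)
    rw [MonGp.map_id, divB_twistβHom]
    rfl

/-- `U` is an automorphism of the data: `η = id_Φ` and `β` objectwise bijective (an involution).
[cite: MochizukiFrdII2008, Rmk 1.2.2 p.10] -/
theorem twistData_isDataAutomorphism : (qpPerfDatum p).IsDataAutomorphism (twistData p) where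
  η_eq := rfl
  bijective A := by
    obtain ⟨⟨⟨⟩⟩⟩ := A
    exact (Function.Involutive.bijective
      (f := twistβHom p ⟨PUnit.unit⟩) fun b => twistβHom_twistβHom p ⟨PUnit.unit⟩ b)

/-- **`Ψ_U : C_v ⥲ C_v`, the induced self-equivalence of `C_v = C(ℚ_p)` of `ofKitQp p`** ([FrdII] Rmk. 1.2.2,
sentence 5; the equivalence is abc-iut-L1-t4's `rmk122SelfEquivalence_holds`). [cite: MochizukiFrdII2008, Rmk 1.2.2 p.10] -/
def twistEquiv : (ofKitQp p).Cv ≌ (ofKitQp p).Cv :=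
  haveI := (qpPerfDatum p).rmk122SelfEquivalence_holds (twistData p) (twistData_isDataAutomorphism p)
  (twistData p).functor.asEquivalence

/-- The functor of `twistEquiv` is `Ψ_U = U.functor`. [cite: MochizukiFrdII2008, Rmk 1.2.2 p.10] -/
theorem twistEquiv_functor : (twistEquiv p).functor = (twistData p).functor := rfl

/-- `Ψ_U` on rational functions: `u_{Ψ_U(φ)} = β(u_φ)`. [cite: MochizukiFrdII2008, Rmk 1.2.2 p.10] -/
theorem unit_twistEquiv_map {X Y : (qpPerfDatum p).frobenioid} (φ : X ⟶ Y) :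
    ModelFrobenioid.unit ((twistEquiv p).functor.map φ) = twistβHom p X.base (ModelFrobenioid.unit φ) := rfl

/-- `Ψ_U` preserves Frobenius degrees. [cite: MochizukiFrdII2008, Rmk 1.2.2 p.10] -/
theorem degFr_twistEquiv_map {X Y : (qpPerfDatum p).frobenioid} (φ : X ⟶ Y) :
    ModelFrobenioid.degFr ((twistEquiv p).functor.map φ) = ModelFrobenioid.degFr φ := rfl

end Twist


end GoodLocalFrobenioid

end Literature.IUT.HodgeTheaters
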